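import Literature.NumberTheory.ComplexMultiplication.EllipticUnits.ImaginaryQuadraticMainConjectureLayerDualityMaps
import Literature.NumberTheory.GaloisCohomology.ShaRestrictedLayerConjTwo
import HarnessLib

/-!
# The class-group row of Johnson-Leung–Kings 2011, Lemma 5.8 — the LOCAL plug (π4b) of `hfcoker` REDUCED TO LOCAL ANNIHILATION:
# the annihilator scheme, the dictionary `Λ₂`-action ↔ conjugations on the layers, and the per-place suppliers

Topic `Literature/NumberTheory/ComplexMultiplication/EllipticUnits` (grouping sub-namespace `JohnsonLeungKings2011.ClassGroupRow`).
Cell `bsd-print-cf2`, width seat `bsd-line-cf2c-w8` g9 (prover).  Sequel of `…ClassGroupRowRange.lean` (`classGroupRow_hfcoker_of_local`: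
the `hfcoker` binder of the cell's descent lemma for the `Λ₂`-linear class-group row `Φ : C.X → I.H` follows from the LOCAL plug
«`∃ r ∉ 𝔭, ∀ n k, proj_{n,k}(r • y) ∈ Ш²_S(K̃_n, μ_{p^k} ⊗ θ′)`»).  THEOREMS ONLY (no definition, no named fact, no instance, no `sorry`).

WHAT (JLK §5.4, proof of Lemma 5.8: the cokernel of `𝒜_∞ → H²` lies in the local terms `⊕_{v ∈ S} lim← H²(K̃_{n,w}, ·)`, which are
finitely generated over `𝒪_p`, i.e. pseudo-null over `Λ`).  Here this is organised POINTWISE and PLACE BY PLACE: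

* §2 **`exists_smul_forall_proj_mem_layerShaRestricted`** (the SCHEME): `K` totally complex, `supp(p𝔣)` finite; if every
  `v ∈ supp(p𝔣)` carries a set `A v ⊆ Λ₂` of ANNIHILATORS, one of which satisfies a multiplicative predicate `P` (meant `∉ 𝔭`), each
  killing the localisations at `v` of all conjugates of all `proj_{n,k}(a • y)`, then some `r` with `P r` (a product over the places)
  puts every `proj_{n,k}(r • y)` in `Ш²_S` (complex places: `Γ_ℂ = 1`).
* §3 the DICTIONARY (pins (P5)(P6)): `proj((1+T₁) • y) = conj_{η₁}(proj y)`, `proj((1+T₂) • y) = conj_{η₂}(proj y)`,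
  `proj(m • y) = m • proj y`, `proj(((1+T_i) − u) • y) = conj_{η_i}(proj y) − u • proj y`.
* §4 the layer localisation in the carriers' currency (`layerCoh`): additivity, the bridge `ShaLayer.layerConj (π σ) = layerConj σ`,
  inner conjugations by `Gal(K̄/K̃_∞)` trivial, commuting conjugations, and `loc_v ∘ conj_{res_v δ} = conj_δ ∘ loc_v`
  (`ShaRestrictedLayerConjTwo`).
* §5 the SUPPLIERS: (a) `m ∈ ℕ` killing the local groups `H²(φ_v⁻¹V̄_n, (μ_{p^k} ⊗ θ′)|)` (all `n, k`) is an annihilator at `v`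
  (`layerLocalization_layerConj_proj_natCast_smul_eq_zero`; meant `m = p^e` where `θ′ ∋ −1` locally); (b) `m · ((1+T_i) − u)` is an
  annihilator at `v` when `η_i = res_v(δ) · h`, `h ∈ Gal(K̄/K̃_∞)`, and the LOCAL operator `m · (conj_δ − u)` kills those groups
  (`layerLocalization_layerConj_proj_T₁/T₂_smul_eq_zero`; meant `u = θ′(δ) = ±1`: by local class field theory `Gal(K̄_v/K_v)` acts on
  `H²(K̃_{n,w}, μ_{p^k}) = Br(K̃_{n,w})[p^k]` trivially, hence as `θ′` on the twist once `θ′` is trivial on `Gal(K̄_v/K̃_{n,w})`).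

What is NOT here: the local class field theory input itself (the local annihilation hypotheses `hloc` are DISPLAYED), and the
choice «one annihilator avoids every height-one `𝔭 ∌ p`» (a height computation in `Λ₂`, done on the Summits side with the cell's
`JLKDescent.not_height_le_one_of_C_mem_of_mem`).  HONEST FRAMING: bookkeeping; no duality, no main conjecture, no case of BSD is proved
here; no summit statement is proved by this seat.

## References
* J. Johnson-Leung, G. Kings, J. reine angew. Math. 653 (2011) = arXiv:0804.2828, §4.2 (p0012:L109–112), §5.4 Lemma 5.8 and its proof
  (p0015:L150–p0016:L20). [JohnsonLeungKings2011]
* J. S. Milne, *Arithmetic Duality Theorems* (2006), I §4 (p. 56), I Cor. 2.3. [MilneADT2006]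
* J.-P. Serre, *Local Fields* (1979), VII §5 Prop. 3. [SerreLocalFields1979]
-/

noncomputable section

open scoped NumberField
open CategoryTheory Function Field IsDedekindDomain NumberField
open Literature.NumberTheory.GaloisRepresentations
open Literature.NumberTheory.GaloisRepresentations.DiscreteGaloisModule
open Literature.NumberTheory.EllipticCurves

/-! ## §2 The annihilator scheme: per-place annihilators ⟹ the local plug (π4b) -/

namespace Literature.NumberTheory.ComplexMultiplication.EllipticUnits.JohnsonLeungKings2011.ClassGroupRow

open Literature.NumberTheory.GaloisCohomology Literature.NumberTheory.GaloisCohomology.ShaLayer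
open Literature.NumberTheory.EllipticCurves.KellerYin2024

variable {K : Type} [Field K] [NumberField K] {p : ℕ} [Fact p.Prime]
  {κ₁ κ₂ : ZpExtension K p} {η₁ η₂ : absoluteGaloisGroup K} {θ' : absoluteGaloisGroup K →ₜ* ℤ_[p]ˣ} {𝔣 : Ideal (𝓞 K)}

/-- **THE ANNIHILATOR SCHEME for the local plug (π4b) of the class-group row.**  Let `K` be totally complex and `supp(p𝔣)`
finite.  Suppose that for every place `v ∈ supp(p𝔣)` a set `A v ⊆ Λ₂` of ANNIHILATORS is given such that (i) some `a ∈ A v`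
satisfies the predicate `P` (meant: `a ∉ 𝔭` for the prime `𝔭` at hand; `P` multiplicative) and (ii) every `a ∈ A v` kills the
localisations at `v` of all conjugates of all level components of `a • y`, for every `y` in the pinned carrier `I.H` of
`H²(𝒪_K[1/p𝔣], Λ(θ′)(1))`.  Then for every `y` some `r` with `P r` (the product of one chosen annihilator per place) has ALL
`proj_{n,k}(r • y) ∈ Ш²_S(K̃_n, μ_{p^k} ⊗ θ′)`.  [cite: JohnsonLeungKings2011, §5.4 Lemma 5.8 and its proof (arXiv p0015:L150–p0016:L20)] [cite: MilneADT2006, I §4 (p. 56)] -/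
theorem exists_smul_forall_proj_mem_layerShaRestricted (I : IwasawaCohomologyData p κ₁ κ₂ η₁ η₂ θ' 𝔣 2)
    (hcx : ∀ w : InfinitePlace K, w.IsComplex) (hfin : (suppPF p 𝔣).Finite)
    (P : IwasawaAlgebra₂ p → Prop) (hP1 : P 1) (hPmul : ∀ a b, P a → P b → P (a * b))
    (A : HeightOneSpectrum (𝓞 K) → Set (IwasawaAlgebra₂ p))
    (hA : ∀ v ∈ suppPF p 𝔣, ∃ a ∈ A v, P a)
    (hkill : ∀ v ∈ suppPF p 𝔣, ∀ a ∈ A v, ∀ (y : I.H) (n k : ℕ) (σ : GaloisGroupUnramifiedOutside K (suppPF p 𝔣)),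
      layerLocalization (suppPF p 𝔣) (muTwist p θ' k) (pairLayerSubgroup κ₁ κ₂ n) (Sum.inr v) 2
        (ShaLayer.layerConj (suppPF p 𝔣) (muTwist p θ' k) (pairLayerSubgroup κ₁ κ₂ n) σ 2 (I.proj n k (a • y))) = 0)
    (y : I.H) :
    ∃ r : IwasawaAlgebra₂ p, P r ∧ ∀ n k : ℕ,
      I.proj n k (r • y) ∈ layerShaRestricted (suppPF p 𝔣) (muTwist p θ' k) (pairLayerSubgroup κ₁ κ₂ n) 2 := by
  classical
  choose a ha hPa using hA
  -- one annihilator per place, `1` off the support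
  let b : HeightOneSpectrum (𝓞 K) → IwasawaAlgebra₂ p := fun v => if hv : v ∈ suppPF p 𝔣 then a v hv else 1
  have hbP : ∀ v, P (b v) := fun v => by
    by_cases hv : v ∈ suppPF p 𝔣
    · simp only [b, dif_pos hv]; exact hPa v hv
    · simp only [b, dif_neg hv]; exact hP1
  have hbA : ∀ v (hv : v ∈ suppPF p 𝔣), b v ∈ A v := fun v hv => by simp only [b, dif_pos hv]; exact ha v hv
  refine ⟨∏ v ∈ hfin.toFinset, b v, Finset.prod_induction _ P hPmul hP1 (fun v _ => hbP v), fun n k => ?_⟩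
  refine (mem_layerShaRestricted_iff (suppPF p 𝔣) (muTwist p θ' k) (pairLayerSubgroup κ₁ κ₂ n) 2 _).mpr
    ⟨fun w σ => layerLocalization_inl_eq_zero_two (suppPF p 𝔣) (muTwist p θ' k) (isOpen_pairLayerSubgroup κ₁ κ₂ n) (hcx w) _,
      fun v hv σ => ?_⟩
  have hvT : v ∈ hfin.toFinset := hfin.mem_toFinset.mpr hv
  rw [← Finset.mul_prod_erase _ _ hvT, mul_smul]
  exact hkill v hv (b v) (hbA v hv) _ n k σ

/-! ## §3 Dictionary: the pinned `Λ₂`-action on the level components, in the layer currency -/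

section Dictionary

variable (I : IwasawaCohomologyData p κ₁ κ₂ η₁ η₂ θ' 𝔣 2)

/-- `proj (m • y) = m • proj y` for a natural number `m` read in `Λ₂`. [cite: JohnsonLeungKings2011, §4.2 (arXiv p0012:L109–112)] -/
theorem proj_natCast_smul (m n k : ℕ) (y : I.H) :
    I.proj n k ((m : IwasawaAlgebra₂ p) • y) = m • I.proj n k y := by
  rw [Nat.cast_smul_eq_nsmul, map_nsmul]

/-- `proj (u • y) = u • proj y` for an integer `u` read in `Λ₂`. [cite: JohnsonLeungKings2011, §4.2 (arXiv p0012:L109–112)] -/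
theorem proj_intCast_smul (u : ℤ) (n k : ℕ) (y : I.H) :
    I.proj n k ((u : IwasawaAlgebra₂ p) • y) = u • I.proj n k y := by
  rw [Int.cast_smul_eq_zsmul, map_zsmul]

/-- **`(1 + T₁)` acts on the level components as `conj_{η₁}`** (pin (P5)). [cite: JohnsonLeungKings2011, §4.2 (arXiv p0012:L109–112)] -/
theorem proj_one_add_X_smul (n k : ℕ) (y : I.H) :
    I.proj n k ((1 + PowerSeries.X : IwasawaAlgebra₂ p) • y) = layerConj p κ₁ κ₂ θ' 𝔣 n k 2 η₁ (I.proj n k y) := by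
  rw [add_smul, one_smul, map_add, I.proj_T₁_smul, add_sub_cancel]

/-- **`(1 + T₂)` acts on the level components as `conj_{η₂}`** (pin (P6)). [cite: JohnsonLeungKings2011, §4.2 (arXiv p0012:L109–112)] -/
theorem proj_one_add_CX_smul (n k : ℕ) (y : I.H) :
    I.proj n k ((1 + (PowerSeries.C (PowerSeries.X : IwasawaAlgebra p) : IwasawaAlgebra₂ p)) • y) =
      layerConj p κ₁ κ₂ θ' 𝔣 n k 2 η₂ (I.proj n k y) := by
  rw [add_smul, one_smul, map_add, I.proj_T₂_smul, add_sub_cancel]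

/-- `((1 + T₁) − u) • y` on the level components: `conj_{η₁} − u`. [cite: JohnsonLeungKings2011, §4.2 (arXiv p0012:L109–112)] -/
theorem proj_one_add_X_sub_intCast_smul (u : ℤ) (n k : ℕ) (y : I.H) :
    I.proj n k ((1 + PowerSeries.X - (u : IwasawaAlgebra₂ p) : IwasawaAlgebra₂ p) • y) =
      layerConj p κ₁ κ₂ θ' 𝔣 n k 2 η₁ (I.proj n k y) - u • I.proj n k y := by
  rw [sub_smul, map_sub, proj_one_add_X_smul, proj_intCast_smul]

/-- `((1 + T₂) − u) • y` on the level components: `conj_{η₂} − u`. [cite: JohnsonLeungKings2011, §4.2 (arXiv p0012:L109–112)] -/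
theorem proj_one_add_CX_sub_intCast_smul (u : ℤ) (n k : ℕ) (y : I.H) :
    I.proj n k ((1 + (PowerSeries.C (PowerSeries.X : IwasawaAlgebra p) : IwasawaAlgebra₂ p) - (u : IwasawaAlgebra₂ p)) • y) =
      layerConj p κ₁ κ₂ θ' 𝔣 n k 2 η₂ (I.proj n k y) - u • I.proj n k y := by
  rw [sub_smul, map_sub, proj_one_add_CX_smul, proj_intCast_smul]

end Dictionary

/-! ## §4 The layer localisation in the carriers' currency -/

section LayerCurrency

variable (p κ₁ κ₂ θ' 𝔣)

omit [NumberField K] in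
/-- The Ш-condition's conjugation by `π σ` IS the carriers' `layerConj σ` (definitional bridge). [cite: SerreLocalFields1979, VII §5] -/
theorem shaLayerConj_eq_layerConj (n k : ℕ) (σ : absoluteGaloisGroup K) (z : layerCoh p κ₁ κ₂ θ' 𝔣 n k 2) :
    ShaLayer.layerConj (suppPF p 𝔣) (muTwist p θ' k) (pairLayerSubgroup κ₁ κ₂ n) (toUnramifiedQuot K (suppPF p 𝔣) σ) 2 z =
      layerConj p κ₁ κ₂ θ' 𝔣 n k 2 σ z := rfl

/-- The layer localisation is additive on the carriers' layer groups: `loc (m • z) = m • loc z`. [cite: MilneADT2006, I §4 (p. 56)] -/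
theorem layerLocalization_nsmul (v : HeightOneSpectrum (𝓞 K)) (n k m : ℕ) (z : layerCoh p κ₁ κ₂ θ' 𝔣 n k 2) :
    layerLocalization (suppPF p 𝔣) (muTwist p θ' k) (pairLayerSubgroup κ₁ κ₂ n) (Sum.inr v) 2 (m • z) =
      m • layerLocalization (suppPF p 𝔣) (muTwist p θ' k) (pairLayerSubgroup κ₁ κ₂ n) (Sum.inr v) 2 z :=
  map_nsmul _ m z

/-- `loc (z − u • w) = loc z − u • loc w`. [cite: MilneADT2006, I §4 (p. 56)] -/
theorem layerLocalization_sub_zsmul (v : HeightOneSpectrum (𝓞 K)) (n k : ℕ) (u : ℤ) (z w : layerCoh p κ₁ κ₂ θ' 𝔣 n k 2) :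
    layerLocalization (suppPF p 𝔣) (muTwist p θ' k) (pairLayerSubgroup κ₁ κ₂ n) (Sum.inr v) 2 (z - u • w) =
      layerLocalization (suppPF p 𝔣) (muTwist p θ' k) (pairLayerSubgroup κ₁ κ₂ n) (Sum.inr v) 2 z -
        u • layerLocalization (suppPF p 𝔣) (muTwist p θ' k) (pairLayerSubgroup κ₁ κ₂ n) (Sum.inr v) 2 w :=
  (map_sub _ z (u • w)).trans (congrArg (fun t => _ - t) (map_zsmul _ u w))

omit [NumberField K] in
/-- `conj_σ (m • z) = m • conj_σ z` on the carriers' layer groups. [cite: SerreLocalFields1979, VII §5] -/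
theorem layerConj_nsmul (n k m : ℕ) (σ : absoluteGaloisGroup K) (z : layerCoh p κ₁ κ₂ θ' 𝔣 n k 2) :
    layerConj p κ₁ κ₂ θ' 𝔣 n k 2 σ (m • z) = m • layerConj p κ₁ κ₂ θ' 𝔣 n k 2 σ z :=
  map_nsmul _ m z

omit [NumberField K] in
/-- `conj_σ (z − u • w) = conj_σ z − u • conj_σ w`. [cite: SerreLocalFields1979, VII §5] -/
theorem layerConj_sub_zsmul (n k : ℕ) (u : ℤ) (σ : absoluteGaloisGroup K) (z w : layerCoh p κ₁ κ₂ θ' 𝔣 n k 2) :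
    layerConj p κ₁ κ₂ θ' 𝔣 n k 2 σ (z - u • w) = layerConj p κ₁ κ₂ θ' 𝔣 n k 2 σ z - u • layerConj p κ₁ κ₂ θ' 𝔣 n k 2 σ w := by
  rw [map_sub, map_zsmul]

/-- The two conjugations commute on the layers (`H²`). [cite: SerreLocalFields1979, VII §5 Prop. 3] -/
theorem layerConj_comm (n k : ℕ) (σ τ : absoluteGaloisGroup K) (z : layerCoh p κ₁ κ₂ θ' 𝔣 n k 2) :
    layerConj p κ₁ κ₂ θ' 𝔣 n k 2 σ (layerConj p κ₁ κ₂ θ' 𝔣 n k 2 τ z) =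
      layerConj p κ₁ κ₂ θ' 𝔣 n k 2 τ (layerConj p κ₁ κ₂ θ' 𝔣 n k 2 σ z) :=
  congrArg (fun f : AddMonoid.End (layerCoh p κ₁ κ₂ θ' 𝔣 n k 2) => f z) (commute_layerConjEnd p κ₁ κ₂ σ τ θ' 𝔣 n k (le_refl 2)).eq

/-- Elements of `Gal(K̄/K̃_∞)` act trivially on the layers (`H²`). [cite: SerreLocalFields1979, VII §5 Prop. 3] -/
theorem layerConj_eq_self_of_mem_pairKer (n k : ℕ) {h : absoluteGaloisGroup K} (hh : h ∈ ZpExtension.pairKer κ₁ κ₂)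
    (z : layerCoh p κ₁ κ₂ θ' 𝔣 n k 2) : layerConj p κ₁ κ₂ θ' 𝔣 n k 2 h z = z :=
  levelConj_eq_self_of_mem p (suppPF p 𝔣) θ' (pairKer_le_pairLayerSubgroup κ₁ κ₂ n hh) (isOpen_pairLayerSubgroup κ₁ κ₂ n) k
    (le_refl 2) z

/-- **Localisation intertwines `conj_{res_v δ}` with the local `conj_δ`** on the carriers' layer groups (`locHom v δ = π (res_v δ)`).
[cite: SerreLocalFields1979, VII §5 Prop. 3] [cite: MilneADT2006, I §4 (p. 56)] -/
theorem layerLocalization_layerConj_absGaloisRestrict (v : HeightOneSpectrum (𝓞 K)) (n k : ℕ)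
    (δ : absoluteGaloisGroup (v.adicCompletion K)) (z : layerCoh p κ₁ κ₂ θ' 𝔣 n k 2) :
    layerLocalization (suppPF p 𝔣) (muTwist p θ' k) (pairLayerSubgroup κ₁ κ₂ n) (Sum.inr v) 2
        (layerConj p κ₁ κ₂ θ' 𝔣 n k 2 (absGaloisRestrict K (v.adicCompletion K) δ) z) =
      (conjMap (TopRep.res (locHom (S := suppPF p 𝔣) v : absoluteGaloisGroup (v.adicCompletion K) →*
            GaloisGroupUnramifiedOutside K (suppPF p 𝔣)) ((muTwist p θ' k).quotientInvariants (ramificationSubgroup K (suppPF p 𝔣))).toTopRep)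
        (((pairLayerSubgroup κ₁ κ₂ n).map (toUnramifiedQuot K (suppPF p 𝔣))).comap
          (locHom (S := suppPF p 𝔣) v : absoluteGaloisGroup (v.adicCompletion K) →* GaloisGroupUnramifiedOutside K (suppPF p 𝔣))) δ 2).hom
        (layerLocalization (suppPF p 𝔣) (muTwist p θ' k) (pairLayerSubgroup κ₁ κ₂ n) (Sum.inr v) 2 z) :=
  layerLocalization_layerConj_locHom (suppPF p 𝔣) (muTwist p θ' k) v δ 2 z

end LayerCurrency

/-! ## §5 The per-place annihilators from LOCAL annihilation data -/

section Suppliers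

variable (I : IwasawaCohomologyData p κ₁ κ₂ η₁ η₂ θ' 𝔣 2)

/-- **A scalar `m ∈ ℕ` that kills the local groups `H²(φ_v⁻¹V̄_n, (μ_{p^k} ⊗ θ′)|)` for all `n, k` is an annihilator at `v`** in the
sense of the scheme `exists_smul_forall_proj_mem_layerShaRestricted` (meant: `m = p^e` at a place where `θ′` takes the value `−1`
on every `Gal(K̄_v/K̃_{n,w})`, so that the local `H²` has order `≤ 2`). [cite: JohnsonLeungKings2011, §5.4 Lemma 5.8 (proof)] [cite: MilneADT2006, I Cor. 2.3] -/
theorem layerLocalization_layerConj_proj_natCast_smul_eq_zero (v : HeightOneSpectrum (𝓞 K)) (m : ℕ)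
    (hloc : ∀ (n k : ℕ) (c : continuousCohomology 2 (subgroupRep
      (TopRep.res (locHom (S := suppPF p 𝔣) v : absoluteGaloisGroup (v.adicCompletion K) →* GaloisGroupUnramifiedOutside K (suppPF p 𝔣))
        ((muTwist p θ' k).quotientInvariants (ramificationSubgroup K (suppPF p 𝔣))).toTopRep)
      (((pairLayerSubgroup κ₁ κ₂ n).map (toUnramifiedQuot K (suppPF p 𝔣))).comap
        (locHom (S := suppPF p 𝔣) v : absoluteGaloisGroup (v.adicCompletion K) →* GaloisGroupUnramifiedOutside K (suppPF p 𝔣))))),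
      m • c = 0)
    (y : I.H) (n k : ℕ) (σ : GaloisGroupUnramifiedOutside K (suppPF p 𝔣)) :
    layerLocalization (suppPF p 𝔣) (muTwist p θ' k) (pairLayerSubgroup κ₁ κ₂ n) (Sum.inr v) 2
      (ShaLayer.layerConj (suppPF p 𝔣) (muTwist p θ' k) (pairLayerSubgroup κ₁ κ₂ n) σ 2
        (I.proj n k ((m : IwasawaAlgebra₂ p) • y))) = 0 := by
  obtain ⟨σ, rfl⟩ := toUnramifiedQuot_surjective K (suppPF p 𝔣) σ
  rw [shaLayerConj_eq_layerConj, proj_natCast_smul, layerConj_nsmul, layerLocalization_nsmul]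
  exact hloc n k _

/-- **The element `m · ((1 + T₁) − u)` is an annihilator at `v`** when `η₁ = res_v(δ) · h` with `h ∈ Gal(K̄/K̃_∞)` and the local
operator `m · (conj_δ − u)` kills the local groups `H²(φ_v⁻¹V̄_n, (μ_{p^k} ⊗ θ′)|)` for all `n, k` (meant: `u = θ′(res_v δ) = ±1`,
`m = p^e`; by local class field theory `conj_δ` acts on `H²(Gal(K̄_v/K̃_{n,w}), μ_{p^k} ⊗ θ′)` as `θ′(δ)` once `θ′` is trivial there,
and the group is killed by `p^e` otherwise). [cite: JohnsonLeungKings2011, §5.4 Lemma 5.8 (proof)] [cite: SerreLocalFields1979, VII §5 Prop. 3] -/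
theorem layerLocalization_layerConj_proj_T₁_smul_eq_zero (v : HeightOneSpectrum (𝓞 K)) (m : ℕ) (u : ℤ)
    (δ : absoluteGaloisGroup (v.adicCompletion K)) (h : absoluteGaloisGroup K) (hh : h ∈ ZpExtension.pairKer κ₁ κ₂)
    (hη : η₁ = absGaloisRestrict K (v.adicCompletion K) δ * h)
    (hloc : ∀ (n k : ℕ) (c : continuousCohomology 2 (subgroupRep
      (TopRep.res (locHom (S := suppPF p 𝔣) v : absoluteGaloisGroup (v.adicCompletion K) →* GaloisGroupUnramifiedOutside K (suppPF p 𝔣))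
        ((muTwist p θ' k).quotientInvariants (ramificationSubgroup K (suppPF p 𝔣))).toTopRep)
      (((pairLayerSubgroup κ₁ κ₂ n).map (toUnramifiedQuot K (suppPF p 𝔣))).comap
        (locHom (S := suppPF p 𝔣) v : absoluteGaloisGroup (v.adicCompletion K) →* GaloisGroupUnramifiedOutside K (suppPF p 𝔣))))),
      m • ((conjMap (TopRep.res (locHom (S := suppPF p 𝔣) v : absoluteGaloisGroup (v.adicCompletion K) →*
            GaloisGroupUnramifiedOutside K (suppPF p 𝔣)) ((muTwist p θ' k).quotientInvariants (ramificationSubgroup K (suppPF p 𝔣))).toTopRep)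
        (((pairLayerSubgroup κ₁ κ₂ n).map (toUnramifiedQuot K (suppPF p 𝔣))).comap
          (locHom (S := suppPF p 𝔣) v : absoluteGaloisGroup (v.adicCompletion K) →* GaloisGroupUnramifiedOutside K (suppPF p 𝔣))) δ 2).hom c -
        u • c) = 0)
    (y : I.H) (n k : ℕ) (σ : GaloisGroupUnramifiedOutside K (suppPF p 𝔣)) :
    layerLocalization (suppPF p 𝔣) (muTwist p θ' k) (pairLayerSubgroup κ₁ κ₂ n) (Sum.inr v) 2
      (ShaLayer.layerConj (suppPF p 𝔣) (muTwist p θ' k) (pairLayerSubgroup κ₁ κ₂ n) σ 2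
        (I.proj n k (((m : IwasawaAlgebra₂ p) * (1 + PowerSeries.X - (u : IwasawaAlgebra₂ p))) • y))) = 0 := by
  obtain ⟨σ, rfl⟩ := toUnramifiedQuot_surjective K (suppPF p 𝔣) σ
  rw [shaLayerConj_eq_layerConj, mul_smul, proj_natCast_smul, proj_one_add_X_sub_intCast_smul, layerConj_nsmul,
    layerConj_sub_zsmul, layerConj_comm, congrArg (layerConj p κ₁ κ₂ θ' 𝔣 n k 2) hη]
  change layerLocalization (suppPF p 𝔣) (muTwist p θ' k) (pairLayerSubgroup κ₁ κ₂ n) (Sum.inr v) 2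
    (m • (levelConj p (suppPF p 𝔣) θ' (pairLayerSubgroup κ₁ κ₂ n) k 2 (absGaloisRestrict K (v.adicCompletion K) δ * h)
      (layerConj p κ₁ κ₂ θ' 𝔣 n k 2 σ (I.proj n k y)) -
      u • layerConj p κ₁ κ₂ θ' 𝔣 n k 2 σ (I.proj n k y))) = 0
  rw [← levelConj_levelConj]
  change layerLocalization (suppPF p 𝔣) (muTwist p θ' k) (pairLayerSubgroup κ₁ κ₂ n) (Sum.inr v) 2
    (m • (layerConj p κ₁ κ₂ θ' 𝔣 n k 2 (absGaloisRestrict K (v.adicCompletion K) δ)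
      (layerConj p κ₁ κ₂ θ' 𝔣 n k 2 h (layerConj p κ₁ κ₂ θ' 𝔣 n k 2 σ (I.proj n k y))) -
      u • layerConj p κ₁ κ₂ θ' 𝔣 n k 2 σ (I.proj n k y))) = 0
  rw [layerConj_eq_self_of_mem_pairKer p κ₁ κ₂ θ' 𝔣 n k hh, layerLocalization_nsmul, layerLocalization_sub_zsmul,
    layerLocalization_layerConj_absGaloisRestrict]
  exact hloc n k _

/-- **The `T₂`-twin**: `m · ((1 + T₂) − u)` is an annihilator at `v` when `η₂ = res_v(δ) · h`, `h ∈ Gal(K̄/K̃_∞)`, and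
`m · (conj_δ − u)` kills the local `H²`'s. [cite: JohnsonLeungKings2011, §5.4 Lemma 5.8 (proof)] [cite: SerreLocalFields1979, VII §5 Prop. 3] -/
theorem layerLocalization_layerConj_proj_T₂_smul_eq_zero (v : HeightOneSpectrum (𝓞 K)) (m : ℕ) (u : ℤ)
    (δ : absoluteGaloisGroup (v.adicCompletion K)) (h : absoluteGaloisGroup K) (hh : h ∈ ZpExtension.pairKer κ₁ κ₂)
    (hη : η₂ = absGaloisRestrict K (v.adicCompletion K) δ * h)
    (hloc : ∀ (n k : ℕ) (c : continuousCohomology 2 (subgroupRep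
      (TopRep.res (locHom (S := suppPF p 𝔣) v : absoluteGaloisGroup (v.adicCompletion K) →* GaloisGroupUnramifiedOutside K (suppPF p 𝔣))
        ((muTwist p θ' k).quotientInvariants (ramificationSubgroup K (suppPF p 𝔣))).toTopRep)
      (((pairLayerSubgroup κ₁ κ₂ n).map (toUnramifiedQuot K (suppPF p 𝔣))).comap
        (locHom (S := suppPF p 𝔣) v : absoluteGaloisGroup (v.adicCompletion K) →* GaloisGroupUnramifiedOutside K (suppPF p 𝔣))))),
      m • ((conjMap (TopRep.res (locHom (S := suppPF p 𝔣) v : absoluteGaloisGroup (v.adicCompletion K) →*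
            GaloisGroupUnramifiedOutside K (suppPF p 𝔣)) ((muTwist p θ' k).quotientInvariants (ramificationSubgroup K (suppPF p 𝔣))).toTopRep)
        (((pairLayerSubgroup κ₁ κ₂ n).map (toUnramifiedQuot K (suppPF p 𝔣))).comap
          (locHom (S := suppPF p 𝔣) v : absoluteGaloisGroup (v.adicCompletion K) →* GaloisGroupUnramifiedOutside K (suppPF p 𝔣))) δ 2).hom c -
        u • c) = 0)
    (y : I.H) (n k : ℕ) (σ : GaloisGroupUnramifiedOutside K (suppPF p 𝔣)) :
    layerLocalization (suppPF p 𝔣) (muTwist p θ' k) (pairLayerSubgroup κ₁ κ₂ n) (Sum.inr v) 2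
      (ShaLayer.layerConj (suppPF p 𝔣) (muTwist p θ' k) (pairLayerSubgroup κ₁ κ₂ n) σ 2
        (I.proj n k (((m : IwasawaAlgebra₂ p) * (1 + (PowerSeries.C (PowerSeries.X : IwasawaAlgebra p) : IwasawaAlgebra₂ p) -
          (u : IwasawaAlgebra₂ p))) • y))) = 0 := by
  obtain ⟨σ, rfl⟩ := toUnramifiedQuot_surjective K (suppPF p 𝔣) σ
  rw [shaLayerConj_eq_layerConj, mul_smul, proj_natCast_smul, proj_one_add_CX_sub_intCast_smul, layerConj_nsmul,
    layerConj_sub_zsmul, layerConj_comm, congrArg (layerConj p κ₁ κ₂ θ' 𝔣 n k 2) hη]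
  change layerLocalization (suppPF p 𝔣) (muTwist p θ' k) (pairLayerSubgroup κ₁ κ₂ n) (Sum.inr v) 2
    (m • (levelConj p (suppPF p 𝔣) θ' (pairLayerSubgroup κ₁ κ₂ n) k 2 (absGaloisRestrict K (v.adicCompletion K) δ * h)
      (layerConj p κ₁ κ₂ θ' 𝔣 n k 2 σ (I.proj n k y)) -
      u • layerConj p κ₁ κ₂ θ' 𝔣 n k 2 σ (I.proj n k y))) = 0
  rw [← levelConj_levelConj]
  change layerLocalization (suppPF p 𝔣) (muTwist p θ' k) (pairLayerSubgroup κ₁ κ₂ n) (Sum.inr v) 2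
    (m • (layerConj p κ₁ κ₂ θ' 𝔣 n k 2 (absGaloisRestrict K (v.adicCompletion K) δ)
      (layerConj p κ₁ κ₂ θ' 𝔣 n k 2 h (layerConj p κ₁ κ₂ θ' 𝔣 n k 2 σ (I.proj n k y))) -
      u • layerConj p κ₁ κ₂ θ' 𝔣 n k 2 σ (I.proj n k y))) = 0
  rw [layerConj_eq_self_of_mem_pairKer p κ₁ κ₂ θ' 𝔣 n k hh, layerLocalization_nsmul, layerLocalization_sub_zsmul,
    layerLocalization_layerConj_absGaloisRestrict]
  exact hloc n k _

end Suppliers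

end Literature.NumberTheory.ComplexMultiplication.EllipticUnits.JohnsonLeungKings2011.ClassGroupRow


end
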